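import Mathlib.RingTheory.Norm.Basic
import Mathlib.LinearAlgebra.Charpoly.BaseChange
import Mathlib.RingTheory.LocalRing.ResidueField.Fiber
import HarnessLib

/-!
# The norm of a finite free algebra detects fibrewise units

Pure commutative algebra (Mathlib currency).  For a commutative `A`-algebra `B` that is finite and
free as an `A`-module and `s : B` (the base-change identity `Nm_{C ⊗ B∕C}(1 ⊗ s) = Nm_{B∕A}(s)` and
`IsUnit (Nm s) ↔ IsUnit s` are ★ `Literature.AlgebraicGeometry.Motives.norm_one_tmul` ∕
`….ProjectiveDescent.isUnit_norm_iff`; their one-line proofs are inlined, not restated):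

* `norm_notMem_iff_forall_liesOver` — **the norm detects fibrewise units**: for a prime
  `𝔭` of `A`, `Algebra.norm A s ∉ 𝔭` iff `s ∉ 𝔮` for every prime `𝔮` of `B` lying over `𝔭`
  (equivalently: `s` is a unit in the fibre ring `κ(𝔭) ⊗[A] B`).

Geometrically: for the finite locally free morphism `p : Spec B → Spec A`, the non-vanishing locus
of `Nm(s)` is the complement of `p(V(s))` — the step of Mumford's construction of stable affine
neighbourhoods for a finite group-scheme action (*Abelian Varieties*, §12, proof of Thm. 1).
THEOREMS ONLY; no definition, no instance, no sorry.

## References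
* [MumfordAV1970] D. Mumford, *Abelian Varieties* (1970), §12 Thm. 1 (p. 111) and its proof (p. 112).
-/

open TensorProduct

namespace Literature.RingTheory.Norm

variable {A B : Type*} [CommRing A] [CommRing B] [Algebra A B]

/-- An element of a commutative ring is a unit iff it lies in no prime ideal. [folklore] -/
private theorem isUnit_iff_forall_notMem_of_isPrime {R : Type*} [CommRing R] (x : R) :
    IsUnit x ↔ ∀ 𝔮 : Ideal R, 𝔮.IsPrime → x ∉ 𝔮 := by
  constructor
  · intro hx 𝔮 h𝔮 hmem
    exact h𝔮.ne_top (Ideal.eq_top_of_isUnit_mem 𝔮 hmem hx)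
  · intro h
    by_contra hx
    have hne : Ideal.span ({x} : Set R) ≠ ⊤ := by
      rwa [Ne, Ideal.span_singleton_eq_top]
    obtain ⟨M, hM, hle⟩ := Ideal.exists_le_maximal _ hne
    exact h M hM.isPrime (hle (Ideal.mem_span_singleton_self x))

/-- **The norm detects fibrewise units.**  For `B` finite free over `A`, a prime `𝔭` of `A` and
`s : B`: `Nm_{B∕A}(s) ∉ 𝔭` iff `s ∉ 𝔮` for every prime `𝔮` of `B` over `𝔭` — i.e. `D(Nm s)` is the
complement of the image of `V(s)` under `Spec B → Spec A`.
[cite: MumfordAV1970, §12 proof of Thm. 1 (p. 112)] -/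
theorem norm_notMem_iff_forall_liesOver [Module.Free A B] [Module.Finite A B]
    (𝔭 : Ideal A) [𝔭.IsPrime] (s : B) :
    Algebra.norm A s ∉ 𝔭 ↔
      ∀ 𝔮 : Ideal B, 𝔮.IsPrime → 𝔮.comap (algebraMap A B) = 𝔭 → s ∉ 𝔮 := by
  -- pass to the fibre ring `κ(𝔭) ⊗[A] B`, finite free over the field `κ(𝔭)`
  -- (★ twins: `Literature.AlgebraicGeometry.Motives.norm_one_tmul` ∕ `….ProjectiveDescent.isUnit_norm_iff`
  -- state the next two `have`s; inlined here to keep this file Mathlib-only and below `AlgebraicGeometry`.)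
  have h1 : Algebra.norm 𝔭.ResidueField ((1 : 𝔭.ResidueField) ⊗ₜ[A] s : 𝔭.Fiber B) =
      algebraMap A 𝔭.ResidueField (Algebra.norm A s) := by
    rw [Algebra.norm_apply, Algebra.norm_apply, ← Algebra.baseChange_lmul, LinearMap.det_baseChange]
  have h2 : IsUnit (Algebra.norm 𝔭.ResidueField ((1 : 𝔭.ResidueField) ⊗ₜ[A] s : 𝔭.Fiber B)) ↔
      IsUnit ((1 : 𝔭.ResidueField) ⊗ₜ[A] s : 𝔭.Fiber B) := by
    rw [Algebra.norm_apply, ← LinearMap.isUnit_iff_isUnit_det, Algebra.lmul_isUnit_iff]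
  have key : Algebra.norm A s ∉ 𝔭 ↔ IsUnit ((1 : 𝔭.ResidueField) ⊗ₜ[A] s : 𝔭.Fiber B) := by
    rw [← h2, h1, isUnit_iff_ne_zero, Ne, Ideal.algebraMap_residueField_eq_zero]
  rw [key, isUnit_iff_forall_notMem_of_isPrime]
  -- the fibre of `Spec B → Spec A` at `𝔭` ≃ `Spec (κ(𝔭) ⊗[A] B)`, `𝔔 ↦ 𝔔.comap includeRight` backwards
  let E := PrimeSpectrum.preimageEquivFiber A B ⟨𝔭, ‹_›⟩
  constructor
  · intro h 𝔮 h𝔮 hover hs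
    let q : PrimeSpectrum.comap (algebraMap A B) ⁻¹' {(⟨𝔭, ‹_›⟩ : PrimeSpectrum A)} :=
      ⟨⟨𝔮, h𝔮⟩, by
        rw [Set.mem_preimage, Set.mem_singleton_iff, PrimeSpectrum.ext_iff,
          PrimeSpectrum.comap_asIdeal]
        exact hover⟩
    have hback : E.symm (E q) = q := E.symm_apply_apply q
    have hq : (E.symm (E q)).1.asIdeal = 𝔮 := by rw [hback]
    have hmem : s ∈ (E.symm (E q)).1.asIdeal := by rw [hq]; exact hs
    -- `(E.symm Q).1.asIdeal = Q.asIdeal.comap includeRight` by definition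
    exact h (E q).asIdeal (E q).2 hmem
  · intro h 𝔔 h𝔔 hmem
    have h2 : PrimeSpectrum.comap (algebraMap A B) (E.symm ⟨𝔔, h𝔔⟩).1 = ⟨𝔭, ‹_›⟩ :=
      (E.symm ⟨𝔔, h𝔔⟩).2
    have hover : ((E.symm ⟨𝔔, h𝔔⟩).1.asIdeal).comap (algebraMap A B) = 𝔭 := by
      have := congrArg PrimeSpectrum.asIdeal h2
      rwa [PrimeSpectrum.comap_asIdeal] at this
    exact h _ (E.symm ⟨𝔔, h𝔔⟩).1.2 hover hmem

end Literature.RingTheory.Norm
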